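/-
Copyright (c) 2026 the pub-hodgecm-mathlib formalisation cell (harness21).  Prover seat hodgecm-mathlib-K2Liu-p27 (g0): Track B «K2-LIT»,
hLiu418 = stmt-HodgeConjecture-24832; LEAD F0P6-plan (g14) BATCH #58 (1) «(F-GK-3) FILE B» (self-executing re-deal 21:55Z; first hand K2Liu-p05 (g7),
hand-over 22:00:35Z), consumer (F-GK-4) ED. 2∕3 K2E5-p16 (g8) (shape confirmed 22:02:51Z); books K2E5-plan.
-/
import Summits.HodgeConjecture.HodgeConjecture.Theorems.K2LiuSiegelCocycleLettersLocalInt   -- part 1: the letters lie in `K_v`, the box is `N_Δ ∩ K_v`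
import HarnessLib

/-!
# Crux `HLiu418`, road `K2_Liu`, #41 KIND 0 (β) Euler face, brick (E4) «GK spherical value», file (F-GK-3) B, part 2 (the value):
# THE SIEGEL INTERTWINING OPERATOR ON THE SPHERICAL SECTION AT A GOOD PLACE — `M_v(s) φ° (1) = aNorm 2 χ_v (νN(N_Δ(F_v) ∩ K_v)) s`

Cell `hodgecm-mathlib`, crux item hLiu418 = `stmt-HodgeConjecture-24832`; squad K2 ∕ K2Liu; prover K2Liu-p27 (g0).  THEOREMS ONLY (no `def`, no instance,
no notation, no named-fact hypothesis, no `sorry`); lane `--supports stmt-HodgeConjecture-24832 --as helper` (count-neutral helper).  ONE FRAME (RULING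
M-156o (c)): `φ := frameConj Q ∘ toLocalFour` (★ B1b-1); the adapted-frame data `(D, Dinv, Q)` are hypotheses, as in ★ B7, ★ (F-GK-2), ★ FILE A (the consumer
takes them from ★ B8-CM `exists_adaptedFrame` and their entrywise integrality cofinitely from ★ `eventually_valuation_algebraMap_le_one`).

THE POINT (Gindikin–Karpelevich for the Siegel parabolic of the quasi-split `U(2,2)(F_v)` on the SPHERICAL vector, [Casselman1980, §3 Thm. 3.1],
[KudlaSweet1997, §1], [HarrisKudlaSweet1996, §6 (6.14)–(6.16)]).  Let `v` be a finite place of `F` with `|2|_w = |δ|_w = 1` and `χ_w` unramified at every `w ∣ v`,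
and let the frame `D`, `D⁻¹` be integral at every `w ∣ v`.  For every SPHERICAL section `φ°` of `I_v(s, χ_v)` (★ D10 `IsSphericalSection`: a Siegel section, right
`K_v = H(𝒪_v)`-invariant, `φ°(1) = 1`), every `1 < re s` and every Haar measure `νN` on `N_Δ(F_v)`:
**`M_v(s) φ° (1) = ∫_{N_Δ(F_v)} φ°(w_Δ u) dνN(u) = aNorm 2 χ_v (νN{u | ↑u ∈ K_v}) s`**, where
`aNorm 2 χ_v vol s = vol · L_F(2s−1, χ_F) L_{E⊗F_v}(2s, χ∘N) L_F(2s+1, χ_F) ∕ (L_F(2s, χ_F) L_F(2s+2, χ_F) L_{E⊗F_v}(2s+1, χ∘N))` (★ T1 `aNorm_two`).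
* §1 non-split `v` (`…_of_forall_eq`): ★ FILE A §3 `localIntertwining_eq_aNorm_mul_of_spherical_of_isGoodPlace` at `K₀ := K_v`, its five letter binders paid by
  part 1 §2, `h := 1`, `φ°(1) = 1`, and the box converted by part 1 `box_eq_setOf_mem_localInt_of_forall_eq`.
* §2 split `v` (`…_of_pair`): ★ (F-GK-2s) §3 `localIntertwining_eq_aNorm_mul_of_spherical_of_pair` at `K₀ := K_v`, seven letters by part 1 §2, the five unit
  scalars by ★ FILE A §2 (`…weylDelta_mul_frameConj_weylSiegel_eq_one`, `…torusElt_one_negInvDelta_eq_one`, `chi_neg_one_eq_one` twice,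
  `…torusElt_negInvDelta_one_mul_prod_norm_eq_one`), box by part 1 `box_eq_setOf_mem_localInt_of_pair`.
* §3 both (`localIntertwining_one_eq_aNorm_of_isSphericalSection`, over ★ `placesOver_cases'`) — EXACTLY the `hGK` binder of ★ (F-GK-4)
  `K2LiuSphericalSiegelValueCM.integral_lambdaLoc_weylDelta_eq_aNorm_of_localIntertwining_eq` at `R := aNorm 2 χ_v · s`, `1 < re s`, for the generic datum —
  and `…_of_isGoodPlace`, reading `|2|_w = 1`, `|δ|_w = 1`, `χ_w` unramified off ★ Lit `LocalSplitting.IsGoodPlace F E δ v 2 T₂ χ_v`.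
HONEST LABEL.  `HC_CM` is proved only modulo the 7 printed citations (2 remaining named inputs: hLiu418 = `stmt-HodgeConjecture-24832`,
h413 = `stmt-HodgeConjecture-24833`) until rung 0 closes.

## References
* [Casselman1980] W. Casselman, *The unramified principal series of p-adic groups I*, Compositio Math. 40 (1980), §3 Thm. 3.1 (`T_w φ_K = c_w(χ) φ_K`).
* [KudlaSweet1997] S. Kudla, W. J. Sweet, *Degenerate principal series representations for U(n,n)*, Israel J. Math. 98 (1997), §1.
* [HarrisKudlaSweet1996] M. Harris, S. Kudla, W. J. Sweet, J. AMS 9 (1996), §6 (6.14)–(6.16) (`a_n(s,χ)/b_n(s,χ)` at `n = 2`).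
* [GelbartRogawski1991] S. Gelbart, J. Rogawski, Invent. Math. 105 (1991), §3.1 (3.1.3) (the good places of the doubled unitary datum).
* [Liu2011] Y. Liu, Algebra Number Theory 5 (2011), §2C (2-4) p. 863 (the local factor of `M(s)` on the spherical section).
-/

set_option autoImplicit false
set_option linter.dupNamespace false -- the mandated namespace repeats `HodgeConjecture.HodgeConjecture`

noncomputable section

open scoped Classical NNReal ENNReal
open NumberField IsDedekindDomain Matrix MeasureTheory Topology
open Literature.NumberTheory.GaloisRepresentations.IsNonarchimedeanLocalField
open Literature.NumberTheory.Automorphic Literature.NumberTheory.Automorphic.UnitaryGroup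
open Literature.NumberTheory.GelbartRogawski1991.AdaptedBlocks
open Literature.NumberTheory.GelbartRogawski1991.UnitaryDualPair.LocalSplitting
open Literature.NumberTheory.K2Lit.LocalSiegelDoubled
open Summit.HodgeConjecture.HodgeConjecture.Cruxes.HLiu418.K2LiuQRationalDefs Summit.HodgeConjecture.HodgeConjecture.Cruxes.HLiu418.K2LiuLocalLFactorDefs
open Summit.HodgeConjecture.HodgeConjecture.Cruxes.HLiu418.K2LiuLocalSiegelIwasawaFrame Summit.HodgeConjecture.HodgeConjecture.Cruxes.HLiu418.K2LiuLocalSiegelIwasawa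
open Summit.HodgeConjecture.HodgeConjecture.Cruxes.HLiu418.K2LiuDoubledUTwoTwoBorelFrame Summit.HodgeConjecture.HodgeConjecture.Cruxes.HLiu418.K2LiuDoubledUTwoTwoWeylCocycle
open Summit.HodgeConjecture.HodgeConjecture.Cruxes.HLiu418.K2LiuDoubledUTwoTwoLevi Summit.HodgeConjecture.HodgeConjecture.Cruxes.HLiu418.K2LiuDoubledUTwoTwoFrameTransport
open Summit.HodgeConjecture.HodgeConjecture.Cruxes.HLiu418.K2LiuUnipDeltaRankOneCoordinates Summit.HodgeConjecture.HodgeConjecture.Cruxes.HLiu418.K2LiuSiegelCocycleLetters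
open Summit.HodgeConjecture.HodgeConjecture.Cruxes.HLiu418.K2LiuSiegelIntertwiningCocycle Summit.HodgeConjecture.HodgeConjecture.Cruxes.HLiu418.K2LiuLocalRingPlaceDecomposition
open Summit.HodgeConjecture.HodgeConjecture.Cruxes.HLiu418.K2LiuA7NormalisedRegularitySetup Summit.HodgeConjecture.HodgeConjecture.Cruxes.HLiu418.K2LiuSiegelCocycleSphericalValue
open Summit.HodgeConjecture.HodgeConjecture.Cruxes.HLiu418.K2LiuSiegelCocycleSphericalValueNormalised
open Summit.HodgeConjecture.HodgeConjecture.Cruxes.HLiu418.K2LiuSiegelCocycleSphericalValueSplit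
open Summit.HodgeConjecture.HodgeConjecture.Cruxes.HLiu418.K2LiuSiegelCocycleLettersLocalInt

namespace Summit.HodgeConjecture.HodgeConjecture.Cruxes.HLiu418.K2LiuSiegelCocycleSphericalLocalInt

variable (F : Type) [Field F] [NumberField F] (E : Type) [Field E] [NumberField E] [Algebra F E]
  [Algebra.IsQuadraticExtension F E] (c : E ≃ₐ[F] E)
  {δ : E} (hcδ : c δ = -δ) (hδ : δ ≠ 0) {d : F} (hd : δ * δ = algebraMap F E d) (v : HeightOneSpectrum (𝓞 F))
  {T₂ : Matrix (Fin 2) (Fin 2) F} (hT₂ : T₂.IsSymm) {J₂D : Matrix (Fin (2 + 2)) (Fin (2 + 2)) E} (hJ₂D : J₂D = (gramD F 2 T₂).map (algebraMap F E))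
  (D Dinv : Matrix (Fin 2) (Fin 2) F) (hDD : D * Dinv = 1) (hDD' : Dinv * D = 1) (Q : GL (Fin (2 + 2)) F)
  (hQm : (Q : Matrix (Fin (2 + 2)) (Fin (2 + 2)) F) = Matrix.reindex (e₂ 2) (e₂ 2) (Matrix.fromBlocks 1 D 1 (-D)))
  (hQ : (Q : Matrix (Fin (2 + 2)) (Fin (2 + 2)) F)ᵀ * gramD F 2 T₂ * (Q : Matrix (Fin (2 + 2)) (Fin (2 + 2)) F) = (StdForm.antidiagonal (2 + 2)).over F)
  (h2 : ∀ w : PlacesOver E v, ValuativeRel.valuation (w.1.adicCompletion E) (2 : w.1.adicCompletion E) = 1)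
  (hδv : ∀ w : PlacesOver E v, ValuativeRel.valuation (w.1.adicCompletion E) (algebraMap E (w.1.adicCompletion E) δ) = 1)
  (hDw : ∀ (w : PlacesOver E v) (i j : Fin 2), ValuativeRel.valuation (w.1.adicCompletion E) (algebraMap E (w.1.adicCompletion E) (algebraMap F E (D i j))) ≤ 1)
  (hDiw : ∀ (w : PlacesOver E v) (i j : Fin 2), ValuativeRel.valuation (w.1.adicCompletion E) (algebraMap E (w.1.adicCompletion E) (algebraMap F E (Dinv i j))) ≤ 1)
  [MeasurableSpace (unipDeltaLocal F E c v 2 (JD := J₂D))] [BorelSpace (unipDeltaLocal F E c v 2 (JD := J₂D))]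
  (νN : Measure (unipDeltaLocal F E c v 2 (JD := J₂D))) [νN.IsHaarMeasure]
  (χv : ∀ w : PlacesOver E v, (w.1.adicCompletion E)ˣ →* ℂˣ)
  (hχu : ∀ (w' : PlacesOver E v) (x : (w'.1.adicCompletion E)ˣ), ‖((χv w' x : ℂˣ) : ℂ)‖ = 1)
  (hχ : ∀ (w : PlacesOver E v) (u : (w.1.adicCompletion E)ˣ), ValuativeRel.valuation (w.1.adicCompletion E) (u : w.1.adicCompletion E) = 1 → χv w u = 1)

/-! ## §1 Non-split place -/

include hDD hDD' hQm hQ h2 hδv hDw hDiw hχu hχ in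
/-- **THE SIEGEL INTERTWINING OPERATOR ON THE SPHERICAL SECTION, NON-SPLIT GOOD PLACE.**  `w` the only place of `E` above `v`; `|2|_w = |δ|_w = 1`, `χ_w`
unramified, the frame `D`, `D⁻¹` integral at `w`.  Then for every spherical section `φ°` of `I_v(s, χ_v)`, `1 < re s`, and every Haar `νN` on `N_Δ(F_v)`:
`M_v(s) φ° (1) = aNorm 2 χ_v (νN{u | ↑u ∈ K_v}) s` (★ FILE A §3 at `K₀ := K_v = H(𝒪_v)`, letters by part 1 §2, box by part 1 §3, `φ°(1) = 1`).
[cite: Casselman1980, §3 Thm. 3.1] [cite: KudlaSweet1997, §1] [cite: HarrisKudlaSweet1996, §6 (6.14)–(6.16)] -/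
theorem localIntertwining_one_eq_aNorm_of_isSphericalSection_of_forall_eq
    {s : ℂ} (hs : 1 < s.re) {f : UnitaryGroup.localPi E c (2 + 2) J₂D v → ℂ} (hf : IsSphericalSection F E c hcδ hδ hd v 2 hT₂ hJ₂D χv s f)
    (w : PlacesOver E v) (hw : ∀ w' : PlacesOver E v, w' = w) :
    localIntertwining F E c v 2 hJ₂D νN f 1 =
      aNorm F E c v 2 χv (νN.real {u : unipDeltaLocal F E c v 2 (JD := J₂D) |
        (u : UnitaryGroup.localPi E c (2 + 2) J₂D v) ∈ UnitaryGroup.localInt E c (2 + 2) J₂D v}) s := by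
  obtain ⟨A, hA⟩ := exists_partialWeylGL F E v w
  have hfK : ∀ g, ∀ k ∈ UnitaryGroup.localInt E c (2 + 2) J₂D v, f (g * k) = f g := fun g k hk => hf.apply_mul_of_mem_localInt hk g
  have h := localIntertwining_eq_aNorm_mul_of_spherical_of_isGoodPlace F E c hcδ hδ hd v hT₂ hJ₂D D Dinv hDD hDD' Q hQm hQ χv hχ hδv νN hχu hDw hDiw
    (UnitaryGroup.localInt E c (2 + 2) J₂D v) (UnitaryGroup.isOpen_localInt E c (2 + 2) J₂D v) hs hf.isLocalSiegelSection hf.isSmooth hfK w hw A hA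
    (frameConj_weylTwo_mem_localInt F E c v hJ₂D D Dinv hDD Q hQm hQ h2 hDw hDiw)
    (frameConj_leviElt_partialWeyl_mem_localInt F E c hcδ hδ v hJ₂D D Dinv hDD Q hQm hQ h2 hDw hDiw w A hA)
    (fun t ht => frameConj_uLongTwo_coord_mem_localInt F E c hcδ v hJ₂D D Dinv hDD Q hQm hQ h2 hδv hDw hDiw t ht)
    (fun t ht => frameConj_uLongTwo_coord_inv_mem_localInt F E c hcδ v hJ₂D D Dinv hDD Q hQm hQ h2 hδv hDw hDiw t ht)
    (fun ζ hζ => frameConj_uMinus_single_mem_localInt F E c hcδ hδ v hJ₂D D Dinv hDD Q hQm hQ h2 hDw hDiw w ζ hζ) 1 (one_mem _)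
  rw [hf.apply_one, mul_one, box_eq_setOf_mem_localInt_of_forall_eq F E c hcδ hδ v hJ₂D D Dinv hDD hDD' Q hQm hQ h2 hδv hDw hDiw w hw] at h
  exact h

/-! ## §2 Split place -/

include hDD hDD' hQm hQ h2 hδv hDw hDiw hχu hχ in
/-- **THE SIEGEL INTERTWINING OPERATOR ON THE SPHERICAL SECTION, SPLIT GOOD PLACE.**  `w₁ ≠ w₂` the places of `E` above `v`; `|2|_{wᵢ} = |δ|_{wᵢ} = 1`, `χ_{wᵢ}`
unramified, the frame integral.  Then for every spherical section `φ°` of `I_v(s, χ_v)`, `1 < re s`, and every Haar `νN` on `N_Δ(F_v)`: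
`M_v(s) φ° (1) = aNorm 2 χ_v (νN{u | ↑u ∈ K_v}) s` (★ (F-GK-2s) §3 at `K₀ := K_v`, letters by part 1 §2, the five unit scalars by ★ FILE A §2, box by part 1 §3).
[cite: Casselman1980, §3 Thm. 3.1] [cite: HarrisKudlaSweet1996, §6 (6.16)] [cite: KudlaSweet1997, §1] -/
theorem localIntertwining_one_eq_aNorm_of_isSphericalSection_of_pair
    {s : ℂ} (hs : 1 < s.re) {f : UnitaryGroup.localPi E c (2 + 2) J₂D v → ℂ} (hf : IsSphericalSection F E c hcδ hδ hd v 2 hT₂ hJ₂D χv s f)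
    (w₁ w₂ : PlacesOver E v) (hne : w₁ ≠ w₂) (hw : ∀ w' : PlacesOver E v, w' = w₁ ∨ w' = w₂) :
    localIntertwining F E c v 2 hJ₂D νN f 1 =
      aNorm F E c v 2 χv (νN.real {u : unipDeltaLocal F E c v 2 (JD := J₂D) |
        (u : UnitaryGroup.localPi E c (2 + 2) J₂D v) ∈ UnitaryGroup.localInt E c (2 + 2) J₂D v}) s := by
  obtain ⟨A₁, hA₁⟩ := exists_partialWeylGL F E v w₁
  obtain ⟨A₂, hA₂⟩ := exists_partialWeylGL F E v w₂
  have hfK : ∀ g, ∀ k ∈ UnitaryGroup.localInt E c (2 + 2) J₂D v, f (g * k) = f g := fun g k hk => hf.apply_mul_of_mem_localInt hk g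
  have h := localIntertwining_eq_aNorm_mul_of_spherical_of_pair F E c hcδ hδ hd v hT₂ hJ₂D D Dinv hDD hDD' Q hQm hQ νN χv hχu
    (UnitaryGroup.localInt E c (2 + 2) J₂D v) (UnitaryGroup.isOpen_localInt E c (2 + 2) J₂D v) hs hf.isLocalSiegelSection hf.isSmooth hfK w₁ w₂ hne hw
    A₁ hA₁ A₂ hA₂ (frameConj_weylTwo_mem_localInt F E c v hJ₂D D Dinv hDD Q hQm hQ h2 hDw hDiw)
    (frameConj_leviElt_partialWeyl_mem_localInt F E c hcδ hδ v hJ₂D D Dinv hDD Q hQm hQ h2 hDw hDiw w₁ A₁ hA₁)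
    (frameConj_leviElt_partialWeyl_mem_localInt F E c hcδ hδ v hJ₂D D Dinv hDD Q hQm hQ h2 hDw hDiw w₂ A₂ hA₂)
    (fun t ht => frameConj_uLongTwo_coord_mem_localInt F E c hcδ v hJ₂D D Dinv hDD Q hQm hQ h2 hδv hDw hDiw t ht)
    (fun t ht => frameConj_uLongTwo_coord_inv_mem_localInt F E c hcδ v hJ₂D D Dinv hDD Q hQm hQ h2 hδv hDw hDiw t ht)
    (fun ζ hζ => frameConj_uMinus_single_mem_localInt F E c hcδ hδ v hJ₂D D Dinv hDD Q hQm hQ h2 hDw hDiw w₁ ζ hζ)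
    (fun ζ hζ => frameConj_uMinus_single_mem_localInt F E c hcδ hδ v hJ₂D D Dinv hDD Q hQm hQ h2 hDw hDiw w₂ ζ hζ)
    (localSiegelCharacter_weylDelta_mul_frameConj_weylSiegel_eq_one F E c v hJ₂D D Dinv hDD Q hQm hQ χv hχ (valuation_det_eq_one_of_integral F E v hDD hDw hDiw) s)
    (localSiegelCharacter_torusElt_one_negInvDelta_eq_one F E c hcδ hδ v hJ₂D D Dinv hDD Q hQm hQ χv hχ hδv s)
    (chi_neg_one_eq_one F E v χv hχ w₁) (chi_neg_one_eq_one F E v χv hχ w₂)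
    (localSiegelCharacter_torusElt_negInvDelta_one_mul_prod_norm_eq_one F E c hcδ hδ v hJ₂D D Dinv hDD Q hQm hQ χv hχ hδv s) 1 (one_mem _)
  rw [hf.apply_one, mul_one, box_eq_setOf_mem_localInt_of_pair F E c hcδ hδ v hJ₂D D Dinv hDD hDD' Q hQm hQ h2 hδv hDw hDiw w₁ w₂ hne hw] at h
  exact h

/-! ## §3 Every good place -/

include hDD hDD' hQm hQ h2 hδv hDw hDiw hχu hχ in
/-- **THE SIEGEL INTERTWINING OPERATOR ON THE SPHERICAL SECTION AT A GOOD PLACE** (both place types, ★ `placesOver_cases'`).  Let `|2|_w = |δ|_w = 1` and `χ_w` be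
unramified at every `w ∣ v`, and let the frame `D`, `D⁻¹` be integral at every `w ∣ v`.  Then for every spherical section `φ°` of `I_v(s, χ_v)` (★ D10
`IsSphericalSection`), every `1 < re s` and every Haar measure `νN` on `N_Δ(F_v)`:
**`M_v(s) φ° (1) = aNorm 2 χ_v (νN{u | ↑u ∈ K_v}) s`** — the `hGK` binder of ★ (F-GK-4) `K2LiuSphericalSiegelValueCM.integral_lambdaLoc_weylDelta_eq_aNorm_of_localIntertwining_eq`
at `R := aNorm 2 χ_v · s`. [cite: Casselman1980, §3 Thm. 3.1] [cite: KudlaSweet1997, §1] [cite: HarrisKudlaSweet1996, §6 (6.14)–(6.16)] [cite: Liu2011, §2C (2-4) p. 863] -/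
theorem localIntertwining_one_eq_aNorm_of_isSphericalSection
    {s : ℂ} (hs : 1 < s.re) {f : UnitaryGroup.localPi E c (2 + 2) J₂D v → ℂ} (hf : IsSphericalSection F E c hcδ hδ hd v 2 hT₂ hJ₂D χv s f) :
    localIntertwining F E c v 2 hJ₂D νN f 1 =
      aNorm F E c v 2 χv (νN.real {u : unipDeltaLocal F E c v 2 (JD := J₂D) |
        (u : UnitaryGroup.localPi E c (2 + 2) J₂D v) ∈ UnitaryGroup.localInt E c (2 + 2) J₂D v}) s := by
  rcases placesOver_cases' F E c v hcδ hδ with ⟨w, hw⟩ | ⟨w₁, w₂, hne, hw⟩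
  · exact localIntertwining_one_eq_aNorm_of_isSphericalSection_of_forall_eq F E c hcδ hδ hd v hT₂ hJ₂D D Dinv hDD hDD' Q hQm hQ h2 hδv hDw hDiw νN χv hχu
      hχ hs hf w hw
  · exact localIntertwining_one_eq_aNorm_of_isSphericalSection_of_pair F E c hcδ hδ hd v hT₂ hJ₂D D Dinv hDD hDD' Q hQm hQ h2 hδv hDw hDiw νN χv hχu hχ hs
      hf w₁ w₂ hne hw

include hDD hDD' hQm hQ hDw hDiw hχu in
/-- **THE SAME AT A GOOD PLACE IN THE SENSE OF ★ Lit `LocalSplitting.IsGoodPlace`** (`|2|_w = 1`, `|δ|_w = 1`, `χ_w` unramified read off its fields `two`, `delta`,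
`chi`; the frame integrality stays a hypothesis): `M_v(s) φ° (1) = aNorm 2 χ_v (νN{u | ↑u ∈ K_v}) s`.
[cite: GelbartRogawski1991, §3.1 (3.1.3)] [cite: Casselman1980, §3 Thm. 3.1] [cite: HarrisKudlaSweet1996, §6 (6.14)–(6.16)] -/
theorem localIntertwining_one_eq_aNorm_of_isSphericalSection_of_isGoodPlace (hv : IsGoodPlace F E δ v 2 T₂ χv)
    {s : ℂ} (hs : 1 < s.re) {f : UnitaryGroup.localPi E c (2 + 2) J₂D v → ℂ} (hf : IsSphericalSection F E c hcδ hδ hd v 2 hT₂ hJ₂D χv s f) :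
    localIntertwining F E c v 2 hJ₂D νN f 1 =
      aNorm F E c v 2 χv (νN.real {u : unipDeltaLocal F E c v 2 (JD := J₂D) |
        (u : UnitaryGroup.localPi E c (2 + 2) J₂D v) ∈ UnitaryGroup.localInt E c (2 + 2) J₂D v}) s :=
  localIntertwining_one_eq_aNorm_of_isSphericalSection F E c hcδ hδ hd v hT₂ hJ₂D D Dinv hDD hDD' Q hQm hQ hv.two hv.delta hDw hDiw νN χv hχu hv.chi hs hf

end Summit.HodgeConjecture.HodgeConjecture.Cruxes.HLiu418.K2LiuSiegelCocycleSphericalLocalInt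

end
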